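import Mathlib
import Summits.MatrixMultiplication.MatrixMultiplication.Theorems.GroupTheoreticSTPPCThesisFatPartnersLines

/-!
# Fat partners of a frame triple in `(ℤ/n)³` — abstract core, III: the pair lemma (STEP 0) and the volume bound

Support file for route `MatrixMultiplication/GroupTheoreticSTPP` (target `CThesis`, stmt-MatrixMultiplication-0593),
cell `mm-stpp` (D-0046), theory statement S9 «fat-partner rigidity» (HOME/mm-stpp-theory/FAT-PARTNERS.md).
Two abstract ingredients of STEP 0/1 of the proof:

* `pair_lemma` (STEP 0, the only place where `n ≥ 6` is used): let `S, T ⊆ (ℤ/n)³` have `n − 1` elements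
  each, let `(s, t) ↦ s + t` be injective on `S × T`, and suppose every `s ∈ S`, `t ∈ T` agree in coordinate
  `p` or in coordinate `q` ("cross-intersecting" projections).  Then all of `S ∪ T` agrees in coordinate
  `p`, or all of it agrees in coordinate `q`, or `T` lies on a line of direction `e_r`, or `S` does.  (The
  remaining configuration — both projections two points in general position, "swapped" — splits `S × T`
  into four blocks on each of which `s + t` is determined by its `r`-coordinate, so `(n−1)² ≤ 4n`, i.e.
  `n ≤ 5`.)
* `not_all_const` (volume bound): three `(n−1)`-sets with `(x,y,z) ↦ x + y + z` injective cannot all be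
  constant in one common coordinate (`(n−1)³ > n²` for `n ≥ 4`).

WHAT THIS IS NOT: the assembled theorem (sequel `…FatPartnersRigidity.lean`); nothing about `ω`.

## References
* H. Cohn, R. Kleinberg, B. Szegedy, C. Umans, FOCS 2005, Def. 5.1, Prop. 5.2.
-/

-- single-conjunct summit: the mandated namespace repeats `MatrixMultiplication`.
set_option linter.dupNamespace false

namespace Summit.MatrixMultiplication.MatrixMultiplication.Theorems

namespace FatPartners

open Finset

variable {n : ℕ}

/-! ### The volume bound -/

/-- A plane `{x_p = c}` of `(ℤ/n)³` injects into `(ℤ/n)²` by the other two coordinates, so a finite set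
inside it has at most `n²` elements. [folklore] -/
theorem card_le_sq_of_plane [NeZero n] {p q r : Fin 3} (hcov : ∀ i : Fin 3, i = p ∨ i = q ∨ i = r)
    {W : Finset (Fin 3 → ZMod n)} {c : ZMod n} (hW : ∀ w ∈ W, w p = c) : W.card ≤ n ^ 2 := by
  have hinj : Set.InjOn (fun w : Fin 3 → ZMod n => (w q, w r)) ↑W := by
    intro w hw w' hw' h
    simp only [Prod.mk.injEq] at h
    funext i
    rcases hcov i with rfl | rfl | rfl
    · rw [hW w hw, hW w' hw']
    · exact h.1
    · exact h.2
  have := Finset.card_le_card_of_injOn (fun w : Fin 3 → ZMod n => (w q, w r)) (fun w _ =>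
    Finset.mem_univ _) hinj
  simpa [Finset.card_univ, ZMod.card, sq] using this

/-- **Volume bound.**  Three sets of size `n − 1` (`n ≥ 4`) on which `(x, y, z) ↦ x + y + z` is injective
cannot all be constant in a common coordinate `p`: the `(n−1)³` distinct sums would lie in a plane of
`n²` points. [folklore] -/
theorem not_all_const [NeZero n] (hn : 4 ≤ n) {p q r : Fin 3} (hcov : ∀ i : Fin 3, i = p ∨ i = q ∨ i = r)
    {X Y Z : Finset (Fin 3 → ZMod n)}
    (hinj : ∀ x ∈ X, ∀ x' ∈ X, ∀ y ∈ Y, ∀ y' ∈ Y, ∀ z ∈ Z, ∀ z' ∈ Z,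
      x + y + z = x' + y' + z' → x = x' ∧ y = y' ∧ z = z')
    (hXc : X.card = n - 1) (hYc : Y.card = n - 1) (hZc : Z.card = n - 1)
    {u v w : ZMod n} (hX : ∀ x ∈ X, x p = u) (hY : ∀ y ∈ Y, y p = v) (hZ : ∀ z ∈ Z, z p = w) :
    False := by
  set f : (Fin 3 → ZMod n) × (Fin 3 → ZMod n) × (Fin 3 → ZMod n) → (Fin 3 → ZMod n) :=
    fun t => t.1 + t.2.1 + t.2.2 with hf
  have hfinj : Set.InjOn f ↑(X ×ˢ (Y ×ˢ Z)) := by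
    rintro ⟨x, y, z⟩ hx ⟨x', y', z'⟩ hx' h
    simp only [Finset.coe_product, Set.mem_prod, Finset.mem_coe] at hx hx'
    obtain ⟨e1, e2, e3⟩ := hinj x hx.1 x' hx'.1 y hx.2.1 y' hx'.2.1 z hx.2.2 z' hx'.2.2 h
    rw [e1, e2, e3]
  have hcard : ((X ×ˢ (Y ×ˢ Z)).image f).card = (n - 1) ^ 3 := by
    rw [Finset.card_image_of_injOn hfinj, Finset.card_product, Finset.card_product, hXc, hYc, hZc]
    ring
  have hplane : ∀ s ∈ (X ×ˢ (Y ×ˢ Z)).image f, s p = u + v + w := by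
    intro s hs
    obtain ⟨⟨x, y, z⟩, hxyz, rfl⟩ := Finset.mem_image.1 hs
    simp only [Finset.mem_product] at hxyz
    simp [f, hX x hxyz.1, hY y hxyz.2.1, hZ z hxyz.2.2]
  have hle := card_le_sq_of_plane hcov hplane
  rw [hcard] at hle
  -- `(n-1)^3 ≤ n^2` is impossible for `n ≥ 4`
  obtain ⟨m, rfl⟩ : ∃ m, n = m + 1 := ⟨n - 1, by omega⟩
  have hm : 3 ≤ m := by omega
  simp only [Nat.add_sub_cancel] at hle
  nlinarith [hle, hm, Nat.mul_le_mul hm (Nat.mul_le_mul hm le_rfl : 3 * m ≤ m * m)]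

/-! ### The pair lemma -/

/-- **Pair lemma (STEP 0).**  Let `S, T ⊆ (ℤ/n)³` have `n − 1` elements each (`n ≥ 6`), let `(s,t) ↦ s+t`
be injective on `S × T`, and suppose every `s ∈ S`, `t ∈ T` agree in coordinate `p` or in coordinate `q`.
Then (a) all of `S ∪ T` agrees in coordinate `p`, or (b) in coordinate `q`, or (c) `T` lies on a line of
direction `e_r`, or (c′) `S` does.  [folklore; the "swapped two-point" configuration would force
`(n−1)² ≤ 4n`] -/
theorem pair_lemma [NeZero n] (hn : 6 ≤ n) {p q r : Fin 3} (hcov : ∀ i : Fin 3, i = p ∨ i = q ∨ i = r)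
    {S T : Finset (Fin 3 → ZMod n)} (hF : ∀ s ∈ S, ∀ t ∈ T, s p = t p ∨ s q = t q)
    (hsum : ∀ s ∈ S, ∀ s' ∈ S, ∀ t ∈ T, ∀ t' ∈ T, s + t = s' + t' → s = s' ∧ t = t')
    (hSc : S.card = n - 1) (hTc : T.card = n - 1) :
    (∃ c, (∀ s ∈ S, s p = c) ∧ ∀ t ∈ T, t p = c) ∨ (∃ c, (∀ s ∈ S, s q = c) ∧ ∀ t ∈ T, t q = c) ∨
      (∃ α β, ∀ t ∈ T, t p = α ∧ t q = β) ∨ (∃ α β, ∀ s ∈ S, s p = α ∧ s q = β) := by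
  by_cases hSl : ∃ α β, ∀ s ∈ S, s p = α ∧ s q = β
  · exact Or.inr (Or.inr (Or.inr hSl))
  by_cases hTl : ∃ α β, ∀ t ∈ T, t p = α ∧ t q = β
  · exact Or.inr (Or.inr (Or.inl hTl))
  -- two elements of `S` (resp. `T`) with different `(p,q)`-projections
  obtain ⟨s₀, hs₀⟩ : S.Nonempty := by rw [← Finset.card_pos, hSc]; omega
  obtain ⟨t₀, ht₀⟩ : T.Nonempty := by rw [← Finset.card_pos, hTc]; omega
  obtain ⟨s₁, hs₁, hs₁ne⟩ : ∃ s₁ ∈ S, ¬ (s₁ p = s₀ p ∧ s₁ q = s₀ q) := by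
    by_contra h; push Not at h; exact hSl ⟨s₀ p, s₀ q, h⟩
  obtain ⟨t₁, ht₁, ht₁ne⟩ : ∃ t₁ ∈ T, ¬ (t₁ p = t₀ p ∧ t₁ q = t₀ q) := by
    by_contra h; push Not at h; exact hTl ⟨t₀ p, t₀ q, h⟩
  by_cases hp01 : s₁ p = s₀ p
  · -- `s₀, s₁` share coordinate `p` and differ in `q`: everything has `x_p = s₀ p`
    have hq01 : s₁ q ≠ s₀ q := fun h => hs₁ne ⟨hp01, h⟩
    have hTp : ∀ t ∈ T, t p = s₀ p := by
      intro t ht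
      rcases hF s₀ hs₀ t ht with h | h
      · exact h.symm
      · rcases hF s₁ hs₁ t ht with h' | h'
        · exact h'.symm.trans hp01
        · exact absurd (h'.trans h.symm) hq01
    refine Or.inl ⟨s₀ p, fun s hs => ?_, hTp⟩
    -- `t₀, t₁` share `p` (both `= s₀ p`), so they differ in `q`
    have htq : t₁ q ≠ t₀ q := fun h => ht₁ne ⟨(hTp t₁ ht₁).trans (hTp t₀ ht₀).symm, h⟩
    rcases hF s hs t₀ ht₀ with h | h
    · exact h.trans (hTp t₀ ht₀)
    · rcases hF s hs t₁ ht₁ with h' | h'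
      · exact h'.trans (hTp t₁ ht₁)
      · exact absurd (h'.symm.trans h) htq
  by_cases hq01 : s₁ q = s₀ q
  · -- symmetric: everything has `x_q = s₀ q`
    have hTq : ∀ t ∈ T, t q = s₀ q := by
      intro t ht
      rcases hF s₀ hs₀ t ht with h | h
      · rcases hF s₁ hs₁ t ht with h' | h'
        · exact absurd (h'.trans h.symm) hp01
        · exact h'.symm.trans hq01
      · exact h.symm
    refine Or.inr (Or.inl ⟨s₀ q, fun s hs => ?_, hTq⟩)
    have htp : t₁ p ≠ t₀ p := fun h => ht₁ne ⟨h, (hTq t₁ ht₁).trans (hTq t₀ ht₀).symm⟩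
    rcases hF s hs t₀ ht₀ with h | h
    · rcases hF s hs t₁ ht₁ with h' | h'
      · exact absurd (h'.symm.trans h) htp
      · exact h'.trans (hTq t₁ ht₁)
    · exact h.trans (hTq t₀ ht₀)
  -- general position: `T` has only the two "swapped" types, `S` only the two fibres; count
  exfalso
  have hTtype : ∀ t ∈ T, (t p = s₀ p ∧ t q = s₁ q) ∨ (t p = s₁ p ∧ t q = s₀ q) := by
    intro t ht
    rcases hF s₀ hs₀ t ht with h | h <;> rcases hF s₁ hs₁ t ht with h' | h'
    · exact absurd (h'.trans h.symm) hp01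
    · exact Or.inl ⟨h.symm, h'.symm⟩
    · exact Or.inr ⟨h'.symm, h.symm⟩
    · exact absurd (h'.trans h.symm) hq01
  -- both types occur (else `T` would lie on a line)
  obtain ⟨u₁, hu₁, hu₁t⟩ : ∃ t ∈ T, t p = s₀ p ∧ t q = s₁ q := by
    by_contra h; push Not at h
    exact hTl ⟨s₁ p, s₀ q, fun t ht => (hTtype t ht).resolve_left (fun h' => h t ht h'.1 h'.2)⟩
  obtain ⟨u₂, hu₂, hu₂t⟩ : ∃ t ∈ T, t p = s₁ p ∧ t q = s₀ q := by
    by_contra h; push Not at h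
    exact hTl ⟨s₀ p, s₁ q, fun t ht => (hTtype t ht).resolve_right (fun h' => h t ht h'.1 h'.2)⟩
  have hStype : ∀ s ∈ S, (s p = s₀ p ∧ s q = s₀ q) ∨ (s p = s₁ p ∧ s q = s₁ q) := by
    intro s hs
    rcases hF s hs u₁ hu₁ with h | h <;> rcases hF s hs u₂ hu₂ with h' | h'
    · exact absurd ((h.trans hu₁t.1).symm.trans (h'.trans hu₂t.1)) (Ne.symm hp01)
    · exact Or.inl ⟨h.trans hu₁t.1, h'.trans hu₂t.2⟩
    · exact Or.inr ⟨h'.trans hu₂t.1, h.trans hu₁t.2⟩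
    · exact absurd ((h'.trans hu₂t.2).symm.trans (h.trans hu₁t.2)) (Ne.symm hq01)
  -- block bound: on a block with constant `(p,q)`-coordinates of `s + t`, `(s,t) ↦ (s+t) r` is injective
  have hblock : ∀ (S' T' : Finset (Fin 3 → ZMod n)), S' ⊆ S → T' ⊆ T →
      (∀ s ∈ S', ∀ s' ∈ S', s p = s' p ∧ s q = s' q) → (∀ t ∈ T', ∀ t' ∈ T', t p = t' p ∧ t q = t' q) →
      S'.card * T'.card ≤ n := by
    intro S' T' hS' hT' hSS hTT
    have hinj : Set.InjOn (fun st : (Fin 3 → ZMod n) × (Fin 3 → ZMod n) => (st.1 + st.2) r)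
        ↑(S' ×ˢ T') := by
      rintro ⟨s, t⟩ hst ⟨s', t'⟩ hst' (h : (s + t) r = (s' + t') r)
      simp only [Finset.coe_product, Set.mem_prod, Finset.mem_coe] at hst hst'
      have he : s + t = s' + t' := by
        funext i
        rcases hcov i with rfl | rfl | rfl
        · simp only [Pi.add_apply]; rw [(hSS s hst.1 s' hst'.1).1, (hTT t hst.2 t' hst'.2).1]
        · simp only [Pi.add_apply]; rw [(hSS s hst.1 s' hst'.1).2, (hTT t hst.2 t' hst'.2).2]
        · exact h
      obtain ⟨e1, e2⟩ := hsum s (hS' hst.1) s' (hS' hst'.1) t (hT' hst.2) t' (hT' hst'.2) he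
      rw [e1, e2]
    have := Finset.card_le_card_of_injOn _ (fun st _ => Finset.mem_univ ((st.1 + st.2) r)) hinj
    rwa [Finset.card_product, Finset.card_univ, ZMod.card] at this
  -- the four blocks
  set S₀ := S.filter (fun s => s p = s₀ p) with hS₀
  set S₁ := S.filter (fun s => ¬ s p = s₀ p) with hS₁
  set T₁ := T.filter (fun t => t p = s₀ p) with hT₁
  set T₂ := T.filter (fun t => ¬ t p = s₀ p) with hT₂
  have hS₀c : ∀ s ∈ S₀, s p = s₀ p ∧ s q = s₀ q := by
    intro s hs
    obtain ⟨hsS, hsp⟩ := Finset.mem_filter.1 hs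
    rcases hStype s hsS with h | h
    · exact h
    · exact absurd (h.1 ▸ hsp : s₁ p = s₀ p) hp01
  have hS₁c : ∀ s ∈ S₁, s p = s₁ p ∧ s q = s₁ q := by
    intro s hs
    obtain ⟨hsS, hsp⟩ := Finset.mem_filter.1 hs
    rcases hStype s hsS with h | h
    · exact absurd h.1 hsp
    · exact h
  have hT₁c : ∀ t ∈ T₁, t p = s₀ p ∧ t q = s₁ q := by
    intro t ht
    obtain ⟨htT, htp⟩ := Finset.mem_filter.1 ht
    rcases hTtype t htT with h | h
    · exact h
    · exact absurd (h.1 ▸ htp : s₁ p = s₀ p) hp01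
  have hT₂c : ∀ t ∈ T₂, t p = s₁ p ∧ t q = s₀ q := by
    intro t ht
    obtain ⟨htT, htp⟩ := Finset.mem_filter.1 ht
    rcases hTtype t htT with h | h
    · exact absurd h.1 htp
    · exact h
  have pc : ∀ (U : Finset (Fin 3 → ZMod n)) (α β : ZMod n), (∀ u ∈ U, u p = α ∧ u q = β) →
      ∀ u ∈ U, ∀ u' ∈ U, u p = u' p ∧ u q = u' q := fun U α β hU u hu u' hu' =>
    ⟨(hU u hu).1.trans (hU u' hu').1.symm, (hU u hu).2.trans (hU u' hu').2.symm⟩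
  have b01 := hblock S₀ T₁ (Finset.filter_subset _ _) (Finset.filter_subset _ _) (pc _ _ _ hS₀c)
    (pc _ _ _ hT₁c)
  have b02 := hblock S₀ T₂ (Finset.filter_subset _ _) (Finset.filter_subset _ _) (pc _ _ _ hS₀c)
    (pc _ _ _ hT₂c)
  have b11 := hblock S₁ T₁ (Finset.filter_subset _ _) (Finset.filter_subset _ _) (pc _ _ _ hS₁c)
    (pc _ _ _ hT₁c)
  have b12 := hblock S₁ T₂ (Finset.filter_subset _ _) (Finset.filter_subset _ _) (pc _ _ _ hS₁c)
    (pc _ _ _ hT₂c)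
  have hSsplit : S₀.card + S₁.card = n - 1 := by
    rw [hS₀, hS₁, Finset.card_filter_add_card_filter_not, hSc]
  have hTsplit : T₁.card + T₂.card = n - 1 := by
    rw [hT₁, hT₂, Finset.card_filter_add_card_filter_not, hTc]
  have hprod : (S₀.card + S₁.card) * (T₁.card + T₂.card) ≤ 4 * n := by
    nlinarith [b01, b02, b11, b12]
  rw [hSsplit, hTsplit] at hprod
  obtain ⟨m, rfl⟩ : ∃ m, n = m + 1 := ⟨n - 1, by omega⟩
  simp only [Nat.add_sub_cancel] at hprod
  nlinarith [hprod, hn]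

end FatPartners

end Summit.MatrixMultiplication.MatrixMultiplication.Theorems
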